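import Mathlib.GroupTheory.Coset.Basic
import Mathlib.GroupTheory.GroupAction.Basic
import Mathlib.GroupTheory.GroupAction.Quotient
import Mathlib.SetTheory.Cardinal.Finite
import Mathlib.LinearAlgebra.Matrix.Symmetric
import Mathlib.Algebra.BigOperators.Ring.Finset
import Mathlib.Tactic.Ring
import HarnessLib

/-!
# Reciprocity of orbit counts for an invariant relation ("detailed balance" of neighbour / Hecke
# operators): `#Stab(y) · N(x,[y]) = #Stab(x) · N(y,[x])`, and self-adjointness for the mass inner
# product `(x|y) = #Stab(x) δ`

Topic `Literature/GroupTheory/Index`; Mathlib-only, everything proved (no definition, no named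
fact, no instance).

Let a group `Γ` act on sets `A` and `B`, and let `R ⊆ A × B` be a `Γ`-invariant relation
(`R (g·a) (g·b) ↔ R a b`). For `a₀ ∈ A`, `b₀ ∈ B` write
`N(a₀,[b₀]) = #{b ∈ Γ·b₀ : R a₀ b}` for the number of elements of the orbit ("class") of `b₀`
related to `a₀`, and `N(b₀,[a₀]) = #{a ∈ Γ·a₀ : R a b₀}`. The content of this file is the identity

  `#Stab_Γ(b₀) · N(a₀,[b₀]) = #Stab_Γ(a₀) · N(b₀,[a₀])`       (`card_stabilizer_mul_card_rel_orbit_comm`)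

valid without any finiteness hypothesis (with `Nat.card = 0` for infinite types), and its proof as
printed by Chenevier–Lannes for Kneser `d`-neighbours of even unimodular lattices
[ChenevierLannes2014, Ch. III, Lemme 1.6, Scholie 1.7, Proposition 2.3]: the set
`Ṽ(a₀,b₀) = {g ∈ Γ : R a₀ (g·b₀)}` is a union of left cosets of `Stab(b₀)`, one for each element of
`Γ·b₀` related to `a₀`, so `#Ṽ(a₀,b₀) = #Stab(b₀) · N(a₀,[b₀])`
(`card_subtype_smul_eq_card_stabilizer_mul`; loc. cit. "`|Ṽois_d(L₁,L₂)| = N_d(L₁,L₂) |O(L₂)|`"),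
and `g ↦ g⁻¹` is a bijection `Ṽ(a₀,b₀) ≃ {g : R (g·a₀) b₀}` (`card_subtype_rel_smul_comm`; loc. cit.
Lemme 1.6, `φ ↦ φ⁻¹`). For a single `Γ`-set and a *symmetric* invariant relation (the neighbour
relation) this is Scholie III.1.7 of loc. cit.,
`N_d(L₁,L₂)/|O(L₁)| = N_d(L₂,L₁)/|O(L₂)|` (`card_stabilizer_mul_card_rel_orbit_comm_of_symm`), i.e.
the matrix `(N(x_i,[x_j]) · #Stab(x_j))_{ij}` is symmetric for any family of points `x`
(`isSymm_of_card_rel_orbit_mul_card_stabilizer`), i.e. the neighbour operator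
`T[x] = Σ_y N(x,[y]) [y]` on the free module on the classes is self-adjoint for the inner product
`(x|y) = #Stab(x) δ_{xy}` (loc. cit. Proposition III.2.3; Nebe–Venkov [NebeVenkov2001]; for codes,
with `Γ = S_N` finite, Nebe [Nebe2005, Thm. 3]) — `sum_weight_mul_vecMul_comm`. For finite `Γ` the
identity is the double count `#(Γ·x) · N(x,[y]) = #(Γ·y) · N(y,[x])` of Nebe's proof
(`card_orbit_mul_card_rel_orbit_comm`). Two purely algebraic consequences of the reciprocity
`w_j N_ij = w_i N_ji` are recorded for use with such matrices: the weighted self-adjointness of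
`c ↦ c N` (`sum_weight_mul_vecMul_comm_of_reciprocity`) and, when the row sums `Σ_j N_ij = c` are
constant (for Kneser neighbours: every lattice has the same number `c_n(d)` of `d`-neighbours,
loc. cit. Prop. III.2.2), the mass vector `(1/w_i)_i` is a left eigenvector of `N` for `c`
(`sum_inv_weight_mul_eq_of_reciprocity`; loc. cit. Prop. III.2.4, Nebe's `σ_N`).

Instances (not formalised here, only the dictionary): Kneser `d`-neighbours — `Γ = O(V)` for the
rational quadratic space `V = ℚ ⊗ L`, `A = B =` unimodular lattices in `V` (the lattices in `V`
isometric to a given one form one `Γ`-orbit, stabilisers `O(L)` finite), `R L M ⟺ L/(L ∩ M)` cyclic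
of order `d` (symmetric, loc. cit. Prop. III.1.1); self-dual codes — `Γ = S_N` on `𝔽^N`,
`R C D ⟺ dim C/(C ∩ D) = k` [Nebe2005, §2.2]; Hecke operators of definite quaternion orders /
Brandt matrices (`w_j B_ij = w_i B_ji`) are treated separately in
`Literature/NumberTheory/Automorphic/BrandtWeightSymmetry.lean` (Eichler's bijection, a relation
that is invariant but not symmetric).

## References

* G. Chenevier, J. Lannes, *Formes automorphes et voisins de Kneser des réseaux de Niemeier*,
  arXiv:1409.7616 (2014), Ch. III §1 (Lemme 1.6, Scholies 1.7–1.8), §2 (Prop. 2.2–2.4)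
  [ChenevierLannes2014]; English edition *Automorphic Forms and Even Unimodular Lattices*,
  Ergebnisse 69, Springer (2019) [ChenevierLannes2019].
* G. Nebe, B. Venkov, *On Siegel modular forms of weight 12*, J. reine angew. Math. 531 (2001)
  49–60 [NebeVenkov2001].
* G. Nebe, *Kneser–Hecke-operators in coding theory*, Abh. Math. Sem. Univ. Hamburg 76 (2006),
  arXiv:math/0509474, Thm. 3 [Nebe2005].

## Design

No new definition: the counts are written as `Nat.card` of subtypes of Mathlib's `MulAction.orbit`,
the weights as `Nat.card (MulAction.stabilizer Γ _)`; all identities are in `ℕ` and hold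
unconditionally (both sides are `0` as soon as a stabiliser or a count is infinite). The coset
decomposition is Mathlib's `QuotientGroup.preimageMkEquivSubgroupProdSet` transported along the
orbit–stabiliser bijection `MulAction.orbitEquivQuotientStabilizer`. Scholie III.1.8 of
[ChenevierLannes2014] (the orbit-by-orbit refinement) is not formalised here.
-/

namespace Literature.GroupTheory.Index

open MulAction

variable {Γ : Type*} [Group Γ] {A : Type*} {B : Type*} [MulAction Γ A] [MulAction Γ B]

/-! ## The coset count `#{g : P (g·b₀)} = #Stab(b₀) · #{b ∈ Γ·b₀ : P b}` -/

/-- For a `Γ`-set `B`, a point `b₀ ∈ B` and any predicate `P` on `B`, the elements `g ∈ Γ` with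
`P (g · b₀)` form a union of left cosets of `Stab_Γ(b₀)`, one for each point of the orbit `Γ · b₀`
satisfying `P`; hence `#{g ∈ Γ : P (g·b₀)} = #Stab_Γ(b₀) · #{b ∈ Γ·b₀ : P b}` (as natural numbers,
`Nat.card`, both sides `0` when infinite). For `P = R a₀` this is
`|Ṽois_d(L₁,L₂)| = N_d(L₁,L₂) · |O(L₂)|`, the displayed equality proving Scholie III.1.7 of
Chenevier–Lannes (orbit–stabiliser for the free right action of `O(L₂)` on `Ṽois_d(L₁,L₂)`).
[cite: ChenevierLannes2014, Ch. III Scholie 1.7 (proof)] -/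
theorem card_subtype_smul_eq_card_stabilizer_mul (P : B → Prop) (b₀ : B) :
    Nat.card {g : Γ // P (g • b₀)} =
      Nat.card (stabilizer Γ b₀) * Nat.card {b : orbit Γ b₀ // P (b : B)} := by
  classical
  let t : Set (Γ ⧸ stabilizer Γ b₀) :=
    {q | P (((orbitEquivQuotientStabilizer Γ b₀).symm q : orbit Γ b₀) : B)}
  have h1 : {g : Γ // P (g • b₀)} ≃ (QuotientGroup.mk ⁻¹' t : Set Γ) :=
    Equiv.subtypeEquivRight fun g => by
      simp only [t, Set.mem_preimage, Set.mem_setOf_eq, orbitEquivQuotientStabilizer_symm_apply]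
  have h3 : (t : Type _) ≃ {b : orbit Γ b₀ // P (b : B)} :=
    Equiv.subtypeEquiv (orbitEquivQuotientStabilizer Γ b₀).symm fun q => Iff.rfl
  rw [Nat.card_congr h1, Nat.card_congr (QuotientGroup.preimageMkEquivSubgroupProdSet _ t),
    Nat.card_prod, Nat.card_congr h3]

/-! ## Inversion `g ↦ g⁻¹` and the reciprocity law -/

/-- **Inversion** [ChenevierLannes2014, Ch. III Lemme 1.6, abstract form]: for a `Γ`-invariant
relation `R` between two `Γ`-sets, `g ↦ g⁻¹` is a bijection
`{g : R a₀ (g·b₀)} ≃ {g : R (g·a₀) b₀}`; in particular the two sets have the same cardinality.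
[cite: ChenevierLannes2014, Ch. III Lemme 1.6] -/
theorem card_subtype_rel_smul_comm (R : A → B → Prop)
    (hR : ∀ (g : Γ) (a : A) (b : B), R (g • a) (g • b) ↔ R a b) (a₀ : A) (b₀ : B) :
    Nat.card {g : Γ // R a₀ (g • b₀)} = Nat.card {g : Γ // R (g • a₀) b₀} :=
  Nat.card_congr <| Equiv.subtypeEquiv (Equiv.inv Γ) fun g => by
    rw [Equiv.inv_apply, ← hR g⁻¹ a₀ (g • b₀), inv_smul_smul]

/-- **Reciprocity of orbit counts** (detailed balance). For a group `Γ` acting on `A` and `B`, a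
`Γ`-invariant relation `R`, and points `a₀ ∈ A`, `b₀ ∈ B`:

  `#Stab_Γ(b₀) · #{b ∈ Γ·b₀ : R a₀ b} = #Stab_Γ(a₀) · #{a ∈ Γ·a₀ : R a b₀}`

in `ℕ` (`Nat.card`; no finiteness hypothesis — both sides vanish when a factor is infinite). Both
sides count `{g ∈ Γ : R a₀ (g·b₀)} ≃ {g ∈ Γ : R (g·a₀) b₀}`
(`card_subtype_smul_eq_card_stabilizer_mul`, `card_subtype_rel_smul_comm`). This is the argument of
[ChenevierLannes2014, Ch. III Scholie 1.7] (there: `Γ = O(V)`, `A = B =` even unimodular lattices in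
`V`, `R =` `d`-neighbourhood). [cite: ChenevierLannes2014, Ch. III Scholie 1.7] -/
theorem card_stabilizer_mul_card_rel_orbit_comm (R : A → B → Prop)
    (hR : ∀ (g : Γ) (a : A) (b : B), R (g • a) (g • b) ↔ R a b) (a₀ : A) (b₀ : B) :
    Nat.card (stabilizer Γ b₀) * Nat.card {b : orbit Γ b₀ // R a₀ (b : B)} =
      Nat.card (stabilizer Γ a₀) * Nat.card {a : orbit Γ a₀ // R (a : A) b₀} := by
  have h1 := card_subtype_smul_eq_card_stabilizer_mul (Γ := Γ) (fun b => R a₀ b) b₀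
  have h2 := card_subtype_smul_eq_card_stabilizer_mul (Γ := Γ) (fun a => R a b₀) a₀
  rw [← h1, ← h2]
  exact card_subtype_rel_smul_comm R hR a₀ b₀

/-- **Scholie III.1.7 of Chenevier–Lannes, abstract form.** For ONE `Γ`-set `A` and a `Γ`-invariant
*symmetric* relation `R` (a "neighbour" relation), with `N(x,[y]) = #{y' ∈ Γ·y : R x y'}`:

  `#Stab_Γ(y) · N(x,[y]) = #Stab_Γ(x) · N(y,[x])`,

i.e. `N(x,[y]) / #Stab(x) = N(y,[x]) / #Stab(y)` — for Kneser `d`-neighbours of even unimodular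
lattices `N_d(L₁,L₂)/|O(L₁)| = N_d(L₂,L₁)/|O(L₂)|`. [cite: ChenevierLannes2014, Ch. III Scholie 1.7] -/
theorem card_stabilizer_mul_card_rel_orbit_comm_of_symm (R : A → A → Prop)
    (hR : ∀ (g : Γ) (a b : A), R (g • a) (g • b) ↔ R a b) (hs : ∀ a b, R a b → R b a) (x y : A) :
    Nat.card (stabilizer Γ y) * Nat.card {y' : orbit Γ y // R x (y' : A)} =
      Nat.card (stabilizer Γ x) * Nat.card {x' : orbit Γ x // R y (x' : A)} := by
  rw [card_stabilizer_mul_card_rel_orbit_comm R hR x y]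
  congr 1
  exact Nat.card_congr (Equiv.subtypeEquivRight fun x' => ⟨fun h => hs _ _ h, fun h => hs _ _ h⟩)

/-- **Finite groups: the double count** behind [Nebe2005, Thm. 3]. For a finite group `Γ`, a
`Γ`-set `A` and a `Γ`-invariant symmetric relation `R`,
`#(Γ·x) · N(x,[y]) = #(Γ·y) · N(y,[x])` (both sides count the related pairs in `Γ·x × Γ·y`; here
deduced from `card_stabilizer_mul_card_rel_orbit_comm_of_symm` and `#(Γ·z) · #Stab(z) = #Γ`).
For self-dual codes of length `N` (`Γ = S_N`, `#(Γ·C) = N!/#Aut(C)`) this is the displayed chain of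
equalities in the proof of loc. cit. [cite: Nebe2005, Thm. 3] -/
theorem card_orbit_mul_card_rel_orbit_comm [Finite Γ] (R : A → A → Prop)
    (hR : ∀ (g : Γ) (a b : A), R (g • a) (g • b) ↔ R a b) (hs : ∀ a b, R a b → R b a) (x y : A) :
    Nat.card (orbit Γ x) * Nat.card {y' : orbit Γ y // R x (y' : A)} =
      Nat.card (orbit Γ y) * Nat.card {x' : orbit Γ x // R y (x' : A)} := by
  have hx : Nat.card (orbit Γ x) * Nat.card (stabilizer Γ x) = Nat.card Γ := by
    rw [← Nat.card_prod, Nat.card_congr (orbitProdStabilizerEquivGroup Γ x)]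
  have hy : Nat.card (orbit Γ y) * Nat.card (stabilizer Γ y) = Nat.card Γ := by
    rw [← Nat.card_prod, Nat.card_congr (orbitProdStabilizerEquivGroup Γ y)]
  have hrec := card_stabilizer_mul_card_rel_orbit_comm_of_symm R hR hs x y
  have hpos : 0 < Nat.card (stabilizer Γ x) * Nat.card (stabilizer Γ y) :=
    Nat.mul_pos Nat.card_pos Nat.card_pos
  refine Nat.eq_of_mul_eq_mul_right hpos ?_
  calc Nat.card (orbit Γ x) * Nat.card {y' : orbit Γ y // R x (y' : A)} *
        (Nat.card (stabilizer Γ x) * Nat.card (stabilizer Γ y))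
        = Nat.card (orbit Γ x) * Nat.card (stabilizer Γ x) *
            (Nat.card (stabilizer Γ y) * Nat.card {y' : orbit Γ y // R x (y' : A)}) := by ring
    _ = Nat.card (orbit Γ y) * Nat.card (stabilizer Γ y) *
            (Nat.card (stabilizer Γ x) * Nat.card {x' : orbit Γ x // R y (x' : A)}) := by
          rw [hx, hrec, hy]
    _ = Nat.card (orbit Γ y) * Nat.card {x' : orbit Γ x // R y (x' : A)} *
        (Nat.card (stabilizer Γ x) * Nat.card (stabilizer Γ y)) := by ring

/-! ## The counts and weights are class functions -/

/-- `N(g·x,[y]) = N(x,[y])`: the number of points of the orbit `Γ·y` related to `x` depends only on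
the orbit of `x` (translate by `g⁻¹` inside `Γ·y`) — "`N_d(L₁,L₂)` ne dépend que de `[L₁]` et `[L₂]`,
… cet entier sera aussi noté `N_d([L₁],[L₂])`" (Chenevier–Lannes, Ch. III §1, paragraph before
Lemme 1.6). [cite: ChenevierLannes2014, Ch. III §1 (before Lemme 1.6)] -/
theorem card_rel_orbit_smul_left (R : A → B → Prop)
    (hR : ∀ (g : Γ) (a : A) (b : B), R (g • a) (g • b) ↔ R a b) (g : Γ) (x : A) (y : B) :
    Nat.card {y' : orbit Γ y // R (g • x) (y' : B)} = Nat.card {y' : orbit Γ y // R x (y' : B)} :=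
  Nat.card_congr <| Equiv.subtypeEquiv (MulAction.toPerm g⁻¹ : Equiv.Perm (orbit Γ y)) fun y' => by
    rw [MulAction.toPerm_apply, orbit.coe_smul, ← hR g⁻¹ (g • x) (y' : B), inv_smul_smul]

/-- `#Stab(g·x) = #Stab(x)`: the weight `|O(x)|` depends only on the orbit (conjugate stabilisers),
so that the inner product `(x|y) = |O(x)| δ_{x,y}` on CLASSES `x, y ∈ X_n` of Chenevier–Lannes'
Proposition III.2.3 is well defined. [cite: ChenevierLannes2014, Ch. III Proposition 2.3] -/
theorem card_stabilizer_smul_eq (g : Γ) (x : A) :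
    Nat.card (stabilizer Γ (g • x)) = Nat.card (stabilizer Γ x) := by
  rw [stabilizer_smul_eq_stabilizer_map_conj]
  exact Nat.card_congr ((stabilizer Γ x).equivMapOfInjective (MulAut.conj g).toMonoidHom
    (MulAut.conj g).injective).symm.toEquiv

/-! ## Matrix form: the neighbour matrix is self-adjoint for the mass inner product -/

/-- **Symmetry of the weighted neighbour matrix** (Chenevier–Lannes Prop. III.2.3 / Nebe–Venkov /
Nebe Thm. 3, abstract form). For a `Γ`-set `A`, a `Γ`-invariant symmetric relation `R` and ANY
family of points `x : ι → A` (e.g. representatives of the orbits = "classes in the genus"), the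
matrix `(N(x_i,[x_j]) · #Stab(x_j))_{i,j}`, `N(x_i,[x_j]) = #{y ∈ Γ·x_j : R x_i y}`, is symmetric.
Equivalently: the operator `T [x_i] = Σ_j N(x_i,[x_j]) [x_j]` is self-adjoint for the inner product
`([x_i]|[x_j]) = #Stab(x_i) δ_ij`. [cite: ChenevierLannes2014, Ch. III Proposition 2.3] -/
theorem isSymm_of_card_rel_orbit_mul_card_stabilizer {ι : Type*} (R : A → A → Prop)
    (hR : ∀ (g : Γ) (a b : A), R (g • a) (g • b) ↔ R a b) (hs : ∀ a b, R a b → R b a) (x : ι → A) :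
    (Matrix.of fun i j : ι =>
      Nat.card {y : orbit Γ (x j) // R (x i) (y : A)} * Nat.card (stabilizer Γ (x j))).IsSymm := by
  refine Matrix.IsSymm.ext fun i j => ?_
  simp only [Matrix.of_apply]
  rw [mul_comm, card_stabilizer_mul_card_rel_orbit_comm_of_symm R hR hs (x j) (x i), mul_comm]

/-- **Weighted self-adjointness from reciprocity** (pure algebra). If `w_j N_ij = w_i N_ji` for all
`i, j` (in a commutative semiring), then for all coordinate vectors `c, d`:
`Σ_j w_j (c N)_j d_j = Σ_i w_i c_i (d N)_i`, i.e. `c ↦ c N` (the action `[x_i] ↦ Σ_j N_ij [x_j]` on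
coordinates) is self-adjoint for the bilinear form `⟨c, d⟩ = Σ_i w_i c_i d_i` — the step
"le scholie 1.7 peut être reformulé de la façon suivante" of Chenevier–Lannes' Proposition III.2.3,
isolated from the group action. [cite: ChenevierLannes2014, Ch. III Proposition 2.3] -/
theorem sum_weight_mul_vecMul_comm_of_reciprocity {ι S : Type*} [Fintype ι] [CommSemiring S]
    (N : ι → ι → S) (w : ι → S) (h : ∀ i j, w j * N i j = w i * N j i) (c d : ι → S) :
    ∑ j, w j * (∑ i, c i * N i j) * d j = ∑ i, w i * c i * (∑ j, d j * N j i) := by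
  simp only [Finset.mul_sum, Finset.sum_mul]
  rw [Finset.sum_comm]
  refine Finset.sum_congr rfl fun i _ => Finset.sum_congr rfl fun j _ => ?_
  calc w j * (c i * N i j) * d j = (w j * N i j) * c i * d j := by ring
    _ = (w i * N j i) * c i * d j := by rw [h i j]
    _ = w i * c i * (d j * N j i) := by ring

/-- **Proposition III.2.3 of Chenevier–Lannes, abstract form**: with
`N_ij = N(x_i,[x_j]) = #{y ∈ Γ·x_j : R x_i y}` and `w_i = #Stab_Γ(x_i)` for a `Γ`-invariant symmetric
relation `R` and any family `x : ι → A` (`ι` finite), the endomorphism `c ↦ c N` of `ℕ^ι` (on the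
basis: `[x_i] ↦ Σ_j N_ij [x_j]`, the neighbour / Kneser–Hecke operator) is self-adjoint for
`(c|d) = Σ_i w_i c_i d_i`. [cite: ChenevierLannes2014, Ch. III Proposition 2.3] -/
theorem sum_weight_mul_vecMul_comm {ι : Type*} [Fintype ι] (R : A → A → Prop)
    (hR : ∀ (g : Γ) (a b : A), R (g • a) (g • b) ↔ R a b) (hs : ∀ a b, R a b → R b a) (x : ι → A)
    (c d : ι → ℕ) :
    ∑ j, Nat.card (stabilizer Γ (x j)) *
        (∑ i, c i * Nat.card {y : orbit Γ (x j) // R (x i) (y : A)}) * d j =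
      ∑ i, Nat.card (stabilizer Γ (x i)) * c i *
        (∑ j, d j * Nat.card {y : orbit Γ (x i) // R (x j) (y : A)}) :=
  sum_weight_mul_vecMul_comm_of_reciprocity
    (fun i j => Nat.card {y : orbit Γ (x j) // R (x i) (y : A)})
    (fun i => Nat.card (stabilizer Γ (x i)))
    (fun i j => card_stabilizer_mul_card_rel_orbit_comm_of_symm R hR hs (x i) (x j)) c d

/-- **The mass vector is an eigenvector** (pure algebra; [ChenevierLannes2014, Ch. III Prop. 2.4],
Nebe's `σ_N`): in a field, if `w_j N_ij = w_i N_ji` for all `i, j`, all `w_i ≠ 0`, and the row sums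
`Σ_j N_ij = c` are constant (for Kneser `d`-neighbours: every lattice of the genus has `c_n(d)`
neighbours, loc. cit. Prop. III.2.2), then `Σ_i w_i⁻¹ N_ij = c · w_j⁻¹` for every `j`, i.e.
`Σ_i w_i⁻¹ [x_i]` is an eigenvector of `[x_i] ↦ Σ_j N_ij [x_j]` with eigenvalue `c` (Chenevier–Lannes
deduce it from Prop. 2.2 + Prop. 2.3 exactly so). [cite: ChenevierLannes2014, Ch. III Proposition 2.4] -/
theorem sum_inv_weight_mul_eq_of_reciprocity {ι K : Type*} [Fintype ι] [Field K]
    (N : ι → ι → K) (w : ι → K) (hw : ∀ i, w i ≠ 0) (h : ∀ i j, w j * N i j = w i * N j i)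
    {c : K} (hc : ∀ i, ∑ j, N i j = c) (j : ι) :
    ∑ i, (w i)⁻¹ * N i j = c * (w j)⁻¹ := by
  have key : ∀ i, (w i)⁻¹ * N i j = (w j)⁻¹ * N j i := fun i => by
    rw [inv_mul_eq_div, inv_mul_eq_div, div_eq_div_iff (hw i) (hw j)]
    calc N i j * w j = w j * N i j := mul_comm _ _
      _ = w i * N j i := h i j
      _ = N j i * w i := mul_comm _ _
  simp_rw [key, ← Finset.mul_sum, hc j, mul_comm]

end Literature.GroupTheory.Index
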